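import Mathlib
import Summits.ValiantsHypothesis.ValiantsHypothesis.Theorems.LacunarySymmetroidMatrixDescartesCensusDefs
import Summits.ValiantsHypothesis.ValiantsHypothesis.Theorems.LacunarySymmetroidMatrixDescartesCensusBox20Reduce
import Summits.ValiantsHypothesis.ValiantsHypothesis.Theorems.KPlusLogSqLawWeakLiftingTowerGraftExponentHalving

/-!
# Tower graft line — EXPONENT HALVING COSTS SIZE DOUBLING (Gram form, every level, every far letter)

Sequel to `…TowerGraftExponentHalving.lean` / `…TowerGraftExponentHalvingAllLevels.lean` (val-sym-lift-p2 g21), LINE (B)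
`Cruxes/WeakLifting/Lines/tower_graft.lean` of the crux `WeakLifting` (stmt-ValiantsHypothesis-19561); calibration of S5
`TowerGraftLaw` against size-multiplication class laws.  NO stub is claimed.

The prequels absorb a far letter `L` at level `2b − e` (`e = d l₁` an existing level) into the `K`-letter class at the price of
size TRIPLING, through the three-block bordering `[[G, x·1, 0], [x·1, 0, 1], [0, 1, L]]` whose corner avoids inverting `L`.  Here the
corner is the SPECTRAL GRAM FORM of the letter: every real symmetric `L` is `U·W·Uᵀ` with `U` square and `W = diag(±1)` an
involution (`exists_mul_invol_mul_transpose`, spectral theorem: `U = P·diag(√|λ|)`, `W = diag(sgn λ)` with `sgn 0 := 1`), and the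
TWO-block bordering `M = [[G, x·U], [x·Uᵀ, −c·W]]` is cleared without inversion (§1, any commutative ring):
`M · [[c·1, 0], [x·W·Uᵀ, 1]] = [[c·G + x²·U W Uᵀ, x·U], [0, −c·W]]` (`borderGram_mul_clear`, uses only `W·W = 1`), hence
`det M · c^{m} = det (c·G + x²·L) · det (−c·W)` (`det_borderGram_smul_mul`).  With `c = X^e`, `x = X^b`, `e ≤ 2b` the monomial cancels in
`ℝ[X]` and `det M = ± X^{e·m} · det (G + X^{2b−e}·L)` — same positive roots, at size `2m` instead of `3m`.  So (§3):
* `posRootLawOn_snoc_halve_two` ★: `d l₁ ≤ 2b → PosRootLawOn (2m) (K+1) B (d, b) → PosRootLawOn m (K+1) B (d, 2b − d l₁)` —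
  ONE HALVING TOWARDS ANY EXISTING LEVEL COSTS ONE DOUBLING OF THE SIZE (every far letter, every rank and signature, no tower
  hypothesis, no additive term; the prequel's `posRootLawOn_snoc_halve` had `3m`);
* `posRootLawOn_snoc_mul_of_le_two_pow_two` ★★: on a support through `0`, `ζ₊(m; d, j·d l₁) ≤ ζ₊(2ⁿ·m; d)` for every `j ≤ 2ⁿ`;
* `posRootLawOn_snoc_of_le_two_pow_two` / `posRootLawOn_snoc_of_log_two` ★★: on a support through the levels `0` and `1`, EVERY far
  level `D` is absorbed at size LINEAR in `D`: `ζ₊(m; d, D) ≤ ζ₊(2^{⌊log₂ D⌋+1}·m; d) ≤ ζ₊(2D·m; d)` (the prequel: `3^{⌊log₂D⌋+1}·m ≈ 3·D^{1.585}·m`).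

READING FOR THE LINE (honest).  The exchange «LETTER axis ⊂ SIZE axis» of the prequels now has LINEAR size cost in the far level:
S5 on supports through `0, 1` follows from any size-multiplication class law `ζ₊(N·m; d) ≤ F(N)·ζ₊(m; d) + A` with `N = 2^{⌊log₂D⌋+1} ≤ 2D`
(the tree's size superadditivity `…SizeSuperadditive.not_posRootLawOn_mul` still forces `F(N) ≥ N`, so pure bordering cannot give S5's
`2^C·B`; the improvement is in the polynomial, `2D` for `3·D^{1.585}`).  For RANK-ONE far letters the D-independent absorption at size
`2m+1` of `…TowerGraftResidualDeterminant` (lift-p3 g16) remains the better tool; for rank `≥ 2` no `D`-independent absorption is known and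
this file's `2D·m` is the state of the exchange.  Conversely every `(K+1)`-letter lower bound at level `D` transfers to a `K`-letter
lower bound at size `2^{⌊log₂D⌋+1}·m`.

HONEST FRAMING: exact identities and their budget-relative reading; nothing on S4/S4b/S4d/S4f/S5/S5ᴸ, TowerB, `WeakLifting`,
Conjecture B, 18050 or VP ≠ VNP; zero crux credit.  Def-free; Mathlib + two census files + the prequel.  Seat: prover
val-sym-lift-p2 g22 (`prover-val-sym-lift-p2-g22-0`), `--supports stmt-ValiantsHypothesis-19561 --as helper`.
-/

-- `Summit.ValiantsHypothesis.ValiantsHypothesis.…` repeats a component by the D-0017 layout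
-- (single-conjunct summit), which the `dupNamespace` linter flags; the name is mandated.
set_option linter.dupNamespace false

namespace Summit.ValiantsHypothesis.ValiantsHypothesis.Theorems.KPlusLogSqLaw.TowerGraft

open Finset Polynomial Matrix
open scoped BigOperators Polynomial
open Summit.ValiantsHypothesis.ValiantsHypothesis.Theorems.LacunarySymmetroidMatrixDescartes (PosRootLawOn)

/-! ## §1 Clearing the Gram-bordered matrix without inverting the corner -/

section BorderGram

variable {ι κ : Type*} [Fintype ι] [DecidableEq ι] [Fintype κ] [DecidableEq κ] {R : Type*} [CommRing R]

/-- clearing the Gram bordering `M = [[G, x·U], [x·Uᵀ, −c·W]]` (`W·W = 1`) by a polynomial (non-inverted) block multiplier: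
`M · [[c·1, 0], [x·W·Uᵀ, 1]] = [[c·G + x²·U W Uᵀ, x·U], [0, −c·W]]`. [folklore] -/
theorem borderGram_mul_clear (G : Matrix ι ι R) (U : Matrix ι κ R) (W : Matrix κ κ R) (hW : W * W = 1) (x c : R) :
    fromBlocks G (x • U) (x • Uᵀ) (-(c • W)) * fromBlocks (c • (1 : Matrix ι ι R)) 0 (x • (W * Uᵀ)) 1 =
      fromBlocks (c • G + (x * x) • (U * W * Uᵀ)) (x • U) 0 (-(c • W)) := by
  rw [fromBlocks_multiply]
  congr 1
  · rw [Matrix.mul_smul, Matrix.mul_one, Matrix.smul_mul, Matrix.mul_smul, smul_smul, Matrix.mul_assoc]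
  · rw [Matrix.mul_zero, Matrix.mul_one, zero_add]
  · rw [Matrix.smul_mul, Matrix.mul_smul, Matrix.mul_one, Matrix.neg_mul, Matrix.smul_mul, Matrix.mul_smul,
      ← Matrix.mul_assoc, hW, Matrix.one_mul, smul_smul, smul_smul, mul_comm x c, add_neg_cancel]
  · rw [Matrix.mul_zero, Matrix.mul_one, zero_add]

/-- determinant form of the clearing: `det M · c^{|ι|} = det (c·G + x²·U W Uᵀ) · det (−c·W)` — for `c` a non-zero-divisor this
identifies `det M` without inverting `c` or `W`. [folklore] -/
theorem det_borderGram_smul_mul (G : Matrix ι ι R) (U : Matrix ι κ R) (W : Matrix κ κ R) (hW : W * W = 1) (x c : R) :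
    (fromBlocks G (x • U) (x • Uᵀ) (-(c • W))).det * c ^ Fintype.card ι =
      (c • G + (x * x) • (U * W * Uᵀ)).det * (-(c • W)).det := by
  have h := congrArg Matrix.det (borderGram_mul_clear G U W hW x c)
  have h1 : (c • (1 : Matrix ι ι R)).det = c ^ Fintype.card ι := by rw [det_smul, det_one, mul_one]
  rw [det_mul, det_fromBlocks_zero₁₂, det_fromBlocks_zero₂₁, det_one, mul_one, h1] at h
  exact h

end BorderGram

/-! ## §2 Every real symmetric matrix is a Gram form `U · diag(±1) · Uᵀ` with `U` square (spectral theorem) -/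

section SpectralGram

variable {m : ℕ}

/-- the sign involution of a real number with `sgn 0 := 1`: `s·s = 1` and `√|a|·s·√|a| = a`. [folklore] -/
theorem sqrt_abs_mul_sign_mul_sqrt_abs (a : ℝ) :
    Real.sqrt |a| * (if a < 0 then -1 else 1) * Real.sqrt |a| = a := by
  have h : Real.sqrt |a| * Real.sqrt |a| = |a| := Real.mul_self_sqrt (abs_nonneg a)
  split_ifs with ha
  · rw [mul_neg_one, neg_mul, h, abs_of_neg ha, neg_neg]
  · rw [mul_one, h, abs_of_nonneg (not_lt.mp ha)]

/-- **spectral Gram form.**  Every real symmetric `L` is `U · W · Uᵀ` with `U` square and `W` a diagonal sign matrix (`W·W = 1`,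
`Wᵀ = W`): `U = P·diag(√|λᵢ|)`, `W = diag(sgn λᵢ)` from the spectral theorem `L = P·diag(λ)·Pᵀ`. [folklore] -/
theorem exists_mul_invol_mul_transpose (L : Matrix (Fin m) (Fin m) ℝ) (hL : L.IsSymm) :
    ∃ U W : Matrix (Fin m) (Fin m) ℝ, W * W = 1 ∧ Wᵀ = W ∧ L = U * W * Uᵀ := by
  classical
  have hH : L.IsHermitian := Matrix.isHermitian_iff_isSymm.2 hL
  set P : Matrix (Fin m) (Fin m) ℝ := (hH.eigenvectorUnitary : Matrix (Fin m) (Fin m) ℝ) with hP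
  set lam : Fin m → ℝ := hH.eigenvalues with hlam
  have hLeq : L = P * Matrix.diagonal lam * star P := by
    simpa [Unitary.conjStarAlgAut_apply, hP, hlam] using hH.spectral_theorem
  have hstar : star P = Pᵀ := by
    rw [Matrix.star_eq_conjTranspose]
    exact Matrix.conjTranspose_eq_transpose_of_trivial P
  refine ⟨P * Matrix.diagonal (fun i => Real.sqrt |lam i|), Matrix.diagonal (fun i => if lam i < 0 then (-1 : ℝ) else 1),
    ?_, Matrix.diagonal_transpose _, ?_⟩
  · rw [Matrix.diagonal_mul_diagonal, ← Matrix.diagonal_one]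
    congr 1
    funext i
    split_ifs <;> norm_num
  · have hdiag : Matrix.diagonal (fun i => Real.sqrt |lam i|) * Matrix.diagonal (fun i => if lam i < 0 then (-1 : ℝ) else 1) *
        Matrix.diagonal (fun i => Real.sqrt |lam i|) = Matrix.diagonal lam := by
      rw [Matrix.diagonal_mul_diagonal, Matrix.diagonal_mul_diagonal]
      congr 1
      funext i
      exact sqrt_abs_mul_sign_mul_sqrt_abs (lam i)
    calc L = P * Matrix.diagonal lam * Pᵀ := by rw [hLeq, hstar]
      _ = P * (Matrix.diagonal (fun i => Real.sqrt |lam i|) * Matrix.diagonal (fun i => if lam i < 0 then (-1 : ℝ) else 1) *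
            Matrix.diagonal (fun i => Real.sqrt |lam i|)) * Pᵀ := by rw [hdiag]
      _ = P * Matrix.diagonal (fun i => Real.sqrt |lam i|) * Matrix.diagonal (fun i => if lam i < 0 then (-1 : ℝ) else 1) *
            (P * Matrix.diagonal (fun i => Real.sqrt |lam i|))ᵀ := by
          rw [Matrix.transpose_mul, Matrix.diagonal_transpose]
          simp only [Matrix.mul_assoc]

end SpectralGram

/-! ## §3 Halving towards any existing level at size `2m`; every multiple of a level, and every level on supports through `0, 1` -/

section HalvingGram

variable {m K B : ℕ}

/-- the Gram-bordered letters: entrywise identification of the pencil on `Fin m ⊕ Fin m` with the two-block bordering of the base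
pencil — the letter `l₁` (level `d l₁`) carries the sign corner `−W`, the far letter is the off-diagonal pair `[[0,U],[Uᵀ,0]]` at the
HALVED level `b`. [this work] -/
theorem borderGram_pencil_eq_level (d : Fin K → ℕ) (l₁ : Fin K) (b : ℕ)
    (S : Fin K → Matrix (Fin m) (Fin m) ℝ) (U W : Matrix (Fin m) (Fin m) ℝ) :
    (∑ l, (X : ℝ[X]) ^ (Fin.snoc d b : Fin (K + 1) → ℕ) l •
        ((Fin.snoc (α := fun _ => Matrix (Fin m ⊕ Fin m) (Fin m ⊕ Fin m) ℝ)
            (fun l => fromBlocks (S l) 0 0 (if l = l₁ then -W else 0))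
            (fromBlocks 0 U Uᵀ 0) l).map C)) =
      fromBlocks (∑ l, (X : ℝ[X]) ^ d l • (S l).map C)
        ((X : ℝ[X]) ^ b • U.map C) ((X : ℝ[X]) ^ b • (U.map C)ᵀ)
        (-((X : ℝ[X]) ^ d l₁ • W.map C)) := by
  have hcorner : ∀ p q, (∑ x, C ((if x = l₁ then -W else 0) p q) * (X : ℝ[X]) ^ d x) =
      -((X : ℝ[X]) ^ d l₁ * C (W p q)) := by
    intro p q
    rw [Finset.sum_eq_single l₁ (fun x _ hx => by rw [if_neg hx, Matrix.zero_apply, C_0, zero_mul])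
      (fun h => absurd (Finset.mem_univ _) h), if_pos rfl, Matrix.neg_apply, C_neg, neg_mul, mul_comm]
  refine Matrix.ext fun i j => ?_
  rw [Matrix.sum_apply, Fin.sum_univ_castSucc]
  simp only [Fin.snoc_castSucc, Fin.snoc_last, Matrix.smul_apply, Matrix.map_apply, smul_eq_mul]
  rcases i with i | i <;> rcases j with j | j <;>
    simp [Matrix.sum_apply, hcorner]

open Summit.ValiantsHypothesis.ValiantsHypothesis.Theorems.LacunarySymmetroidMatrixDescartes.Census in
/-- **ONE HALVING TOWARDS ANY EXISTING LEVEL COSTS ONE SIZE DOUBLING.**  For every letter index `l₁` and every `b` with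
`d l₁ ≤ 2b`: `PosRootLawOn (2m) (K+1) B (d, b) → PosRootLawOn m (K+1) B (d, 2b − d l₁)`, i.e.
`ζ₊(m; d, D) ≤ ζ₊(2m; d, (D + d l₁)/2)` whenever `D + d l₁` is even.  The far letter `L = U W Uᵀ` (spectral Gram form) is the
Schur complement of the bordering `[[G, X^b U], [X^b Uᵀ, −X^{d l₁} W]]`, cleared WITHOUT inversion (`det_borderGram_smul_mul` with
`c = X^{d l₁}`, then cancellation of the monomial in `ℝ[X]`).  Every rank and signature, no tower hypothesis, no additive term.
[this work] -/
theorem posRootLawOn_snoc_halve_two (d : Fin K → ℕ) (l₁ : Fin K) (b : ℕ) (hb : d l₁ ≤ 2 * b)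
    (h : PosRootLawOn (m + m) (K + 1) B (Fin.snoc d b)) :
    PosRootLawOn m (K + 1) B (Fin.snoc d (2 * b - d l₁)) := by
  intro S hS
  set L : Matrix (Fin m) (Fin m) ℝ := S (Fin.last K) with hL
  set G : Matrix (Fin m) (Fin m) ℝ[X] := ∑ l, (X : ℝ[X]) ^ d l • (S (Fin.castSucc l)).map C with hG
  have hsplit : (∑ l, (X : ℝ[X]) ^ (Fin.snoc d (2 * b - d l₁) : Fin (K + 1) → ℕ) l • (S l).map C) =
      G + (X : ℝ[X]) ^ (2 * b - d l₁) • L.map C := by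
    rw [Fin.sum_univ_castSucc]
    simp only [Fin.snoc_castSucc, Fin.snoc_last, hG, hL]
  -- spectral Gram form of the far letter
  obtain ⟨U, W, hWW, hWt, hLUW⟩ := exists_mul_invol_mul_transpose L (hS (Fin.last K))
  set T : Fin (K + 1) → Matrix (Fin m ⊕ Fin m) (Fin m ⊕ Fin m) ℝ :=
    Fin.snoc (α := fun _ => Matrix (Fin m ⊕ Fin m) (Fin m ⊕ Fin m) ℝ)
      (fun l => fromBlocks (S (Fin.castSucc l)) 0 0 (if l = l₁ then -W else 0))
      (fromBlocks 0 U Uᵀ 0) with hT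
  set e : Fin m ⊕ Fin m ≃ Fin (m + m) := finSumFinEquiv with he
  have hTsymm : ∀ l, (T l).IsSymm := by
    intro l
    refine Fin.lastCases ?_ (fun l => ?_) l
    · simp only [hT, Fin.snoc_last, Matrix.IsSymm, fromBlocks_transpose, transpose_zero, transpose_transpose]
    · simp only [hT, Fin.snoc_castSucc, Matrix.IsSymm, fromBlocks_transpose, transpose_zero, (hS _).eq]
      congr 1
      split_ifs
      · rw [transpose_neg, hWt]
      · rw [transpose_zero]
  have hB := h (fun l => Matrix.reindex e e (T l)) (fun l => (hTsymm l).submatrix _)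
  have hpencil := borderGram_pencil_eq_level (m := m) d l₁ b (fun l => S (Fin.castSucc l)) U W
  -- determinant bookkeeping
  have hWW' : W.map C * W.map C = (1 : Matrix (Fin m) (Fin m) ℝ[X]) := by
    rw [← Matrix.map_mul, hWW, Matrix.map_one C C_0 C_1]
  have hdetW : W.det * W.det = 1 := by rw [← det_mul, hWW, det_one]
  have hdetW0 : W.det ≠ 0 := left_ne_zero_of_mul_eq_one hdetW
  have hUt : (U.map C)ᵀ = Uᵀ.map C := Matrix.transpose_map
  have hXe : ((X : ℝ[X]) ^ d l₁) ^ m ≠ 0 := pow_ne_zero _ (pow_ne_zero _ X_ne_zero)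
  have hclear := det_borderGram_smul_mul G (U.map C) (W.map C) hWW' ((X : ℝ[X]) ^ b) ((X : ℝ[X]) ^ d l₁)
  have hLmap : U.map C * W.map C * (U.map C)ᵀ = L.map C := by
    rw [hUt, ← Matrix.map_mul, ← Matrix.map_mul, ← hLUW]
  have hfactor : (X : ℝ[X]) ^ d l₁ • G + ((X : ℝ[X]) ^ b * (X : ℝ[X]) ^ b) • (U.map C * W.map C * (U.map C)ᵀ) =
      (X : ℝ[X]) ^ d l₁ • (G + (X : ℝ[X]) ^ (2 * b - d l₁) • L.map C) := by
    rw [hLmap, smul_add, smul_smul, ← pow_add, ← pow_add, ← two_mul, Nat.add_sub_cancel' hb]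
  have hnegW : (-((X : ℝ[X]) ^ d l₁ • W.map C)).det = (-1) ^ m * ((X : ℝ[X]) ^ d l₁) ^ m * C W.det := by
    rw [det_neg, det_smul, Fintype.card_fin, ← RingHom.mapMatrix_apply, ← RingHom.map_det]
    ring
  rw [hfactor, det_smul, Fintype.card_fin, hnegW] at hclear
  -- `hclear : det M * (X^e)^m = (X^e)^m * det (G + X^D L) * ((-1)^m * (X^e)^m * C det W)`
  have hdet : (∑ l, (X : ℝ[X]) ^ (Fin.snoc d b : Fin (K + 1) → ℕ) l • (Matrix.reindex e e (T l)).map C).det =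
      (X : ℝ[X]) ^ (d l₁ * m) * (C ((-1) ^ m * W.det) *
        (G + (X : ℝ[X]) ^ (2 * b - d l₁) • L.map C).det) := by
    rw [sum_smul_map_reindex, Matrix.det_reindex_self, hT, hpencil]
    refine mul_right_cancel₀ hXe ?_
    rw [hclear, ← pow_mul, C_mul, C_pow, C_neg, C_1]
    ring
  have hc0 : (-1 : ℝ) ^ m * W.det ≠ 0 := mul_ne_zero (pow_ne_zero _ (by norm_num)) hdetW0
  have hroots := posRoots_X_pow_mul_eq (d l₁ * m)
    (C ((-1 : ℝ) ^ m * W.det) * (G + (X : ℝ[X]) ^ (2 * b - d l₁) • L.map C).det)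
  rw [Polynomial.roots_C_mul _ hc0, ← hdet] at hroots
  rw [hsplit, ← hroots]
  exact hB

/-- **EVERY MULTIPLE OF AN EXISTING LEVEL IS ABSORBED AT SIZE `2ⁿ·m`.**  On a support `d` containing the level `0` (letter `l₀`),
for every letter `l₁`, every `n` and every `j ≤ 2ⁿ`: `PosRootLawOn (2ⁿ·m) K B d → PosRootLawOn m (K+1) B (d, j·d l₁)` — binary descent
on `j` as in the prequel (`posRootLawOn_snoc_mul_of_le_two_pow`, size `3ⁿ·m`), each halving now a doubling. [this work] -/
theorem posRootLawOn_snoc_mul_of_le_two_pow_two (d : Fin K → ℕ) (l₀ : Fin K) (hl₀ : d l₀ = 0) (l₁ : Fin K) (n : ℕ) :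
    ∀ {m : ℕ} (j : ℕ), j ≤ 2 ^ n → PosRootLawOn (2 ^ n * m) K B d →
      PosRootLawOn m (K + 1) B (Fin.snoc d (d l₁ * j)) := by
  induction n with
  | zero =>
    intro m j hj h
    rw [pow_zero, one_mul] at h
    rw [pow_zero] at hj
    rcases Nat.le_one_iff_eq_zero_or_eq_one.mp hj with rfl | rfl
    · rw [mul_zero, ← hl₀]
      exact posRootLawOn_snoc_self d l₀ h
    · rw [mul_one]
      exact posRootLawOn_snoc_self d l₁ h
  | succ n ih =>
    intro m j hj h
    have h2 : PosRootLawOn (2 ^ n * (m + m)) K B d := by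
      have e2 : 2 ^ (n + 1) * m = 2 ^ n * (m + m) := by ring
      rw [e2] at h
      exact h
    obtain ⟨i, rfl | rfl⟩ := Nat.even_or_odd' j
    · have hi : i ≤ 2 ^ n := by rw [pow_succ] at hj; omega
      have step := posRootLawOn_snoc_halve_two d l₀ (d l₁ * i) (by rw [hl₀]; exact Nat.zero_le _) (ih i hi h2)
      rw [hl₀, Nat.sub_zero] at step
      rw [show d l₁ * (2 * i) = 2 * (d l₁ * i) by ring]
      exact step
    · have hi : i + 1 ≤ 2 ^ n := by rw [pow_succ] at hj; omega
      have step := posRootLawOn_snoc_halve_two d l₁ (d l₁ * (i + 1)) (by nlinarith) (ih (i + 1) hi h2)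
      rw [show 2 * (d l₁ * (i + 1)) - d l₁ = d l₁ * (2 * i + 1) by
        rw [show 2 * (d l₁ * (i + 1)) = d l₁ * (2 * i + 1) + d l₁ by ring, Nat.add_sub_cancel]] at step
      exact step

/-- **HEADLINE — ON A SUPPORT THROUGH THE LEVELS `0` AND `1`, EVERY FAR LETTER IS ABSORBED BY THE `K`-LETTER CLASS AT SIZE
LINEAR IN ITS LEVEL:** `ζ₊(m; d, D) ≤ ζ₊(2ⁿ·m; d)` for every `D ≤ 2ⁿ`, i.e. size `≤ 2D·m` for the least such `n`
(the prequel: `3ⁿ·m`).  READING: S5 (`TowerGraftLaw`) on such supports FOLLOWS from any size-multiplication class law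
`ζ₊(N·m; d) ≤ F(N)·ζ₊(m; d) + A(N, m)` with `N = 2^{⌈log₂ D⌉}`; not discharged by S4d (tower guard; `F` forced `≥ N` by size
superadditivity).  Zero stub credit. [this work] -/
theorem posRootLawOn_snoc_of_le_two_pow_two (d : Fin K → ℕ) (l₀ l₁ : Fin K) (hl₀ : d l₀ = 0) (hl₁ : d l₁ = 1) (n : ℕ)
    {m : ℕ} (D : ℕ) (hD : D ≤ 2 ^ n) (h : PosRootLawOn (2 ^ n * m) K B d) :
    PosRootLawOn m (K + 1) B (Fin.snoc d D) := by
  have := posRootLawOn_snoc_mul_of_le_two_pow_two (B := B) d l₀ hl₀ l₁ n D hD h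
  rwa [hl₁, one_mul] at this

/-- the same with the size written through `Nat.log 2 D`: `ζ₊(m; d, D) ≤ ζ₊(2^{log₂ D + 1}·m; d) ≤ ζ₊(2D·m; d)` for EVERY `D`.
[this work] -/
theorem posRootLawOn_snoc_of_log_two (d : Fin K → ℕ) (l₀ l₁ : Fin K) (hl₀ : d l₀ = 0) (hl₁ : d l₁ = 1) {m : ℕ} (D : ℕ)
    (h : PosRootLawOn (2 ^ (Nat.log 2 D + 1) * m) K B d) : PosRootLawOn m (K + 1) B (Fin.snoc d D) :=
  posRootLawOn_snoc_of_le_two_pow_two d l₀ l₁ hl₀ hl₁ (Nat.log 2 D + 1) D (Nat.lt_pow_succ_log_self one_lt_two D).le h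

end HalvingGram

end Summit.ValiantsHypothesis.ValiantsHypothesis.Theorems.KPlusLogSqLaw.TowerGraft
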